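import Literature.MathematicalPhysics.QuantumFieldTheory.Balaban1983to89.BlockAveragingEMLAnalyticMean
import Literature.MathematicalPhysics.QuantumFieldTheory.Balaban1983to89.BlockAveragingPlaquetteBound

/-!
# The exp-mean-log GAUGE-FIBRE MAP `W ↦ eml(…, h_i W*, …) · W` IS INJECTIVE on the small window — the one-variable inversion input of the
# private-coordinate road to Bałaban's small-field analyticity ((0.4) of [Balaban1987RG1] p. 253 in its distinguished bond, p. 267)

Cell `pub-ymgap` (YM-PLAN Track A), width seat `pub-ymgap-dag-n09-w6` g3; helper of the K1 item (`--supports`, count-neutral).  Pure normed-algebra analysis over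
the tree's `ExpMeanLog.eml` ∕ `B7TransferAnalyticMean.meanCLM` ∕ `BlockAveragingEMLAnalyticMean` ∕ `BlockAveragingPlaquetteBound`; nothing of Bałaban's is asserted.

WHY.  In the private coordinate `g = U(β(c))` of a coarse bond `c` (the central crossing bond; print's distinguished bond `b₀(c)` of the `h`-operator
«`(hB)(b₀(c)) = h(c)B(c)`», [Balaban1987RG1] p. 267) the (0.4) block average reads, with `W = pre·g·post`, `Ū′(c) = K(W) := eml(F_W)·W`,
`(F_W)_i = 1` at the central indices and `h_i W*` at the off-central ones (`BlockAveragingEMLHaarAC.avgFun_update_centralBond_self`, `fibreFamily`).  The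
private-coordinate fibred chart of the averaging (`T4TriangularFibredChart` → `…N09HregOfPerBondChartsAtRecord` → `…N09PerBondChartsOfInjectivityWindows`)
displays, per bond, a window on which `K` is INJECTIVE.  THIS FILE proves that injectivity on the window `{W : ‖W‖ ≤ 1, ‖h_i W* − 1‖ ≤ α (i off-central)}`
as soon as `α ≤ 1/24` and `m/|I| + 150·α < 1` (`m` = number of off-central indices; `1 − m/|I| ≥ |I|⁻¹` when a central index exists — the same flavour
as the `157·α < |I|⁻¹` of `…N07CentralResponseOnto`), by a CONTRACTION argument: `E(W) := eml(F_W)` is `(m/|I| + 144α)`-Lipschitz on the window (mean-value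
inequality along the segment `F_{W₂} + t(F_{W₁} − F_{W₂})`, which stays `α`-close to `1`, with the tree's `‖D eml(U) − mean‖ ≤ 144‖·‖‖U − 1‖` and the
fact that the direction has NO central components, so its mean has norm `≤ (m/|I|)‖W₁ − W₂‖`), while `‖E(W) − 1‖ ≤ 6α`; from `E(W₁)W₁ = E(W₂)W₂` one gets
`E(W₁)(W₁ − W₂) = (E(W₂) − E(W₁))W₂`, whence `(1 − 6α)‖W₁ − W₂‖ ≤ (m/|I| + 144α)‖W₁ − W₂‖`.

CONTENTS (0 def, 0 sorry).  §1 the family and its window: `norm_fibreFamily_sub_one_le`, `norm_fibreFamily_sub_le`, `norm_meanCLM_fibreFamily_sub_le`,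
`norm_segment_sub_one_le`.  §2 ★ `norm_eml_fibreFamily_sub_le` (the Lipschitz bound).  §3 ★★★ `eml_fibreMap_injOn` (injectivity on the window), `eml_fibreMap_eq_imp_eq`.

HONEST FRAMING.  Generic normed `ℂ`-algebra with a norm-preserving star (`‖h_i‖ ≤ 1`, `‖W‖ ≤ 1` as hypotheses — unitaries in the `L²`-operator norm); count-neutral;
no window AT THE RECORD is constructed here (that is the successor's reading through `fibreMap`∕`pre`∕`post`), no Jacobian law, no estimate of Bałaban's; N09 NOT
discharged; K1 NOT closed; counts unmoved.  One finite four-torus programme at fixed `ε`; R4 closes the conditional rung `BalabanLadder.UV` only — not ℝ⁴ ∕ OS ∕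
mass gap ∕ Clay.  No `sorry`, `axiom`, `def`, `instance`, `notation`.
-/

noncomputable section

open Set Metric NormedSpace

namespace Literature.MathematicalPhysics.QuantumFieldTheory.Balaban1983to89.EMLFibreMapInjective

open ExpMeanLog (eml differentiableAt_eml)
open B7TransferAnalyticMean (meanCLM meanCLM_apply)
open BlockAveragingEMLAnalyticMean (norm_fderiv_eml_sub_mean_le)
open BlockAveragingPlaquetteBound (norm_eml_sub_one_le_six_mul)

variable {ι : Type*} [Fintype ι] {𝔸 : Type*} [NormedRing 𝔸] [NormedAlgebra ℂ 𝔸] [CompleteSpace 𝔸] [StarRing 𝔸] [NormedStarGroup 𝔸]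
  (cen : ι → Prop) [DecidablePred cen] (h : ι → 𝔸)

/-! ## §1  The W-coordinate family `F_W = (1 ↦ central, h_i W* ↦ off-central)` and its window -/

omit [NormedAlgebra ℂ 𝔸] [CompleteSpace 𝔸] [NormedStarGroup 𝔸] in
/-- On the window, the family is `α`-close to `1` (the central components ARE `1`). [cite: Balaban1987RG1, (0.4) p.253 (bookkeeping)] -/
theorem norm_fibreFamily_sub_one_le {α : ℝ} (hα : 0 ≤ α) {W : 𝔸} (hW : ∀ i, ¬ cen i → ‖h i * star W - 1‖ ≤ α) :
    ‖(fun i => if cen i then (1 : 𝔸) else h i * star W) - 1‖ ≤ α := by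
  refine (pi_norm_le_iff_of_nonneg hα).2 fun i => ?_
  by_cases hc : cen i
  · simp only [Pi.sub_apply, Pi.one_apply, hc, if_true, sub_self, norm_zero]; exact hα
  · simp only [Pi.sub_apply, Pi.one_apply, hc, if_false]; exact hW i hc

omit [NormedAlgebra ℂ 𝔸] [CompleteSpace 𝔸] in
/-- The family is `1`-Lipschitz in `W` (`‖h_i‖ ≤ 1`, the star is isometric). [cite: Balaban1987RG1, (0.4) p.253 (bookkeeping)] -/
theorem norm_fibreFamily_sub_le (hh : ∀ i, ¬ cen i → ‖h i‖ ≤ 1) (W₁ W₂ : 𝔸) :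
    ‖(fun i => if cen i then (1 : 𝔸) else h i * star W₁) - (fun i => if cen i then (1 : 𝔸) else h i * star W₂)‖ ≤ ‖W₁ - W₂‖ := by
  refine (pi_norm_le_iff_of_nonneg (norm_nonneg _)).2 fun i => ?_
  by_cases hc : cen i
  · simp only [Pi.sub_apply, hc, if_true, sub_self, norm_zero]; exact norm_nonneg _
  · simp only [Pi.sub_apply, hc, if_false]
    rw [← mul_sub, ← star_sub]
    calc ‖h i * star (W₁ - W₂)‖ ≤ ‖h i‖ * ‖star (W₁ - W₂)‖ := norm_mul_le _ _
      _ ≤ 1 * ‖W₁ - W₂‖ := by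
          rw [norm_star]; exact mul_le_mul_of_nonneg_right (hh i hc) (norm_nonneg _)
      _ = ‖W₁ - W₂‖ := one_mul _

omit [CompleteSpace 𝔸] in
/-- **The gain**: the difference of two families has NO central components, so its MEAN has norm at most `(m/|I|)·‖W₁ − W₂‖`, `m` the number of off-central
indices. [cite: Balaban1987RG1, (0.4) p.253 (bookkeeping)] -/
theorem norm_meanCLM_fibreFamily_sub_le (hh : ∀ i, ¬ cen i → ‖h i‖ ≤ 1) (W₁ W₂ : 𝔸) :
    ‖meanCLM ι 𝔸 ((fun i => if cen i then (1 : 𝔸) else h i * star W₁) - (fun i => if cen i then (1 : 𝔸) else h i * star W₂))‖ ≤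
      ((Finset.univ.filter fun i => ¬ cen i).card : ℝ) / (Fintype.card ι : ℝ) * ‖W₁ - W₂‖ := by
  rw [meanCLM_apply]
  have hsum : ∑ j, ((fun i => if cen i then (1 : 𝔸) else h i * star W₁) - (fun i => if cen i then (1 : 𝔸) else h i * star W₂)) j =
      ∑ j ∈ Finset.univ.filter (fun i => ¬ cen i), h j * star (W₁ - W₂) := by
    rw [Finset.sum_filter]
    refine Finset.sum_congr rfl fun j _ => ?_
    by_cases hc : cen j
    · simp only [Pi.sub_apply, hc, if_true, sub_self, not_true_eq_false, if_false]
    · simp only [Pi.sub_apply, hc, if_false, not_false_eq_true, if_true, star_sub, mul_sub]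
  rw [hsum, norm_smul, norm_inv, Complex.norm_natCast]
  have hterm : ∀ j ∈ Finset.univ.filter (fun i => ¬ cen i), ‖h j * star (W₁ - W₂)‖ ≤ ‖W₁ - W₂‖ := by
    intro j hj
    have hc : ¬ cen j := (Finset.mem_filter.1 hj).2
    calc ‖h j * star (W₁ - W₂)‖ ≤ ‖h j‖ * ‖star (W₁ - W₂)‖ := norm_mul_le _ _
      _ ≤ 1 * ‖W₁ - W₂‖ := by rw [norm_star]; exact mul_le_mul_of_nonneg_right (hh j hc) (norm_nonneg _)
      _ = ‖W₁ - W₂‖ := one_mul _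
  have hs : ‖∑ j ∈ Finset.univ.filter (fun i => ¬ cen i), h j * star (W₁ - W₂)‖ ≤
      ((Finset.univ.filter fun i => ¬ cen i).card : ℝ) * ‖W₁ - W₂‖ := by
    calc _ ≤ ∑ j ∈ Finset.univ.filter (fun i => ¬ cen i), ‖h j * star (W₁ - W₂)‖ := norm_sum_le _ _
      _ ≤ ∑ j ∈ Finset.univ.filter (fun i => ¬ cen i), ‖W₁ - W₂‖ := Finset.sum_le_sum hterm
      _ = _ := by rw [Finset.sum_const, nsmul_eq_mul]
  calc (Fintype.card ι : ℝ)⁻¹ * ‖∑ j ∈ Finset.univ.filter (fun i => ¬ cen i), h j * star (W₁ - W₂)‖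
      ≤ (Fintype.card ι : ℝ)⁻¹ * (((Finset.univ.filter fun i => ¬ cen i).card : ℝ) * ‖W₁ - W₂‖) :=
        mul_le_mul_of_nonneg_left hs (inv_nonneg.2 (Nat.cast_nonneg _))
    _ = _ := by ring

omit [CompleteSpace 𝔸] [StarRing 𝔸] [NormedStarGroup 𝔸] in
/-- A point of the segment between two families `α`-close to `1` is `α`-close to `1`. [cite: Balaban1987RG1, (0.4) p.253 (bookkeeping)] -/
theorem norm_segment_sub_one_le {α : ℝ} {F₁ F₂ : ι → 𝔸} (h₁ : ‖F₁ - 1‖ ≤ α) (h₂ : ‖F₂ - 1‖ ≤ α) {t : ℝ} (ht : t ∈ Icc (0 : ℝ) 1) :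
    ‖F₂ + t • (F₁ - F₂) - 1‖ ≤ α := by
  have heq : F₂ + t • (F₁ - F₂) - 1 = t • (F₁ - 1) + (1 - t) • (F₂ - 1) := by
    simp only [smul_sub, sub_smul, one_smul]; abel
  rw [heq]
  calc ‖t • (F₁ - 1) + (1 - t) • (F₂ - 1)‖ ≤ ‖t • (F₁ - 1)‖ + ‖(1 - t) • (F₂ - 1)‖ := norm_add_le _ _
    _ = t * ‖F₁ - 1‖ + (1 - t) * ‖F₂ - 1‖ := by
        rw [norm_smul, norm_smul, Real.norm_of_nonneg ht.1, Real.norm_of_nonneg (sub_nonneg.2 ht.2)]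
    _ ≤ t * α + (1 - t) * α := add_le_add (mul_le_mul_of_nonneg_left h₁ ht.1) (mul_le_mul_of_nonneg_left h₂ (sub_nonneg.2 ht.2))
    _ = α := by ring

/-! ## §2  The Lipschitz bound for `E(W) = eml(F_W)` on the window -/

/-- ★ **`E(W) = eml(F_W)` IS `(m/|I| + 144α)`-LIPSCHITZ ON THE WINDOW** (mean-value inequality along the segment of families, the tree's
`‖D eml(U) − mean‖ ≤ 144‖·‖‖U − 1‖` on `‖U − 1‖ ≤ 1/24`, and §1's bound on the mean of the direction). [cite: Balaban1987RG1, (0.4) p.253 and p.267] -/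
theorem norm_eml_fibreFamily_sub_le (hh : ∀ i, ¬ cen i → ‖h i‖ ≤ 1) {α : ℝ} (hα0 : 0 ≤ α) (hα : α ≤ 1 / 24) {W₁ W₂ : 𝔸}
    (hW₁ : ∀ i, ¬ cen i → ‖h i * star W₁ - 1‖ ≤ α) (hW₂ : ∀ i, ¬ cen i → ‖h i * star W₂ - 1‖ ≤ α) :
    ‖eml (fun i => if cen i then (1 : 𝔸) else h i * star W₁) - eml (fun i => if cen i then (1 : 𝔸) else h i * star W₂)‖ ≤
      (((Finset.univ.filter fun i => ¬ cen i).card : ℝ) / (Fintype.card ι : ℝ) + 144 * α) * ‖W₁ - W₂‖ := by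
  set F₁ : ι → 𝔸 := fun i => if cen i then (1 : 𝔸) else h i * star W₁ with hF₁
  set F₂ : ι → 𝔸 := fun i => if cen i then (1 : 𝔸) else h i * star W₂ with hF₂
  have h1 : ‖F₁ - 1‖ ≤ α := norm_fibreFamily_sub_one_le cen h hα0 hW₁
  have h2 : ‖F₂ - 1‖ ≤ α := norm_fibreFamily_sub_one_le cen h hα0 hW₂
  have hD : ‖F₁ - F₂‖ ≤ ‖W₁ - W₂‖ := norm_fibreFamily_sub_le cen h hh W₁ W₂
  have hmean : ‖meanCLM ι 𝔸 (F₁ - F₂)‖ ≤ ((Finset.univ.filter fun i => ¬ cen i).card : ℝ) / (Fintype.card ι : ℝ) * ‖W₁ - W₂‖ :=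
    norm_meanCLM_fibreFamily_sub_le cen h hh W₁ W₂
  -- the path `φ t = eml (F₂ + t • (F₁ − F₂))` and its derivative
  have hseg : ∀ t ∈ Icc (0 : ℝ) 1, ‖F₂ + t • (F₁ - F₂) - 1‖ ≤ α := fun t ht => norm_segment_sub_one_le h1 h2 ht
  have hdiff : ∀ t ∈ Icc (0 : ℝ) 1, DifferentiableAt ℂ (eml : (ι → 𝔸) → 𝔸) (F₂ + t • (F₁ - F₂)) := by
    intro t ht
    refine differentiableAt_eml fun i => ?_
    have hi : ‖(F₂ + t • (F₁ - F₂) - 1) i‖ ≤ ‖F₂ + t • (F₁ - F₂) - 1‖ := norm_le_pi_norm _ i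
    have : ‖(F₂ + t • (F₁ - F₂)) i - 1‖ ≤ α := by simpa only [Pi.sub_apply, Pi.one_apply] using hi.trans (hseg t ht)
    linarith
  have hderiv : ∀ t ∈ Icc (0 : ℝ) 1, HasDerivWithinAt (fun s : ℝ => eml (F₂ + s • (F₁ - F₂)))
      ((fderiv ℂ (eml : (ι → 𝔸) → 𝔸) (F₂ + t • (F₁ - F₂))) (F₁ - F₂)) (Icc (0 : ℝ) 1) t := by
    intro t ht
    have hl : HasDerivAt (fun s : ℝ => F₂ + s • (F₁ - F₂)) (F₁ - F₂) t := by
      simpa using ((hasDerivAt_id t).smul_const (F₁ - F₂)).const_add F₂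
    have he : HasFDerivAt (eml : (ι → 𝔸) → 𝔸) ((fderiv ℂ (eml : (ι → 𝔸) → 𝔸) (F₂ + t • (F₁ - F₂))).restrictScalars ℝ)
        (F₂ + t • (F₁ - F₂)) := ((hdiff t ht).hasFDerivAt).restrictScalars ℝ
    exact (he.comp_hasDerivAt t hl).hasDerivWithinAt
  have hbound : ∀ t ∈ Ico (0 : ℝ) 1, ‖(fderiv ℂ (eml : (ι → 𝔸) → 𝔸) (F₂ + t • (F₁ - F₂))) (F₁ - F₂)‖ ≤
      (((Finset.univ.filter fun i => ¬ cen i).card : ℝ) / (Fintype.card ι : ℝ) + 144 * α) * ‖W₁ - W₂‖ := by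
    intro t ht
    have ht' : t ∈ Icc (0 : ℝ) 1 := ⟨ht.1, ht.2.le⟩
    have hU : ‖F₂ + t • (F₁ - F₂) - 1‖ ≤ 1 / 24 := (hseg t ht').trans hα
    have hkey := norm_fderiv_eml_sub_mean_le hU (F₁ - F₂)
    calc ‖(fderiv ℂ (eml : (ι → 𝔸) → 𝔸) (F₂ + t • (F₁ - F₂))) (F₁ - F₂)‖
        ≤ ‖meanCLM ι 𝔸 (F₁ - F₂)‖ + ‖(fderiv ℂ (eml : (ι → 𝔸) → 𝔸) (F₂ + t • (F₁ - F₂))) (F₁ - F₂) - meanCLM ι 𝔸 (F₁ - F₂)‖ :=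
          norm_le_insert' _ _
      _ ≤ ((Finset.univ.filter fun i => ¬ cen i).card : ℝ) / (Fintype.card ι : ℝ) * ‖W₁ - W₂‖ + 144 * ‖F₁ - F₂‖ * ‖F₂ + t • (F₁ - F₂) - 1‖ :=
          add_le_add hmean hkey
      _ ≤ ((Finset.univ.filter fun i => ¬ cen i).card : ℝ) / (Fintype.card ι : ℝ) * ‖W₁ - W₂‖ + 144 * ‖W₁ - W₂‖ * α := by
          gcongr
          exact hseg t ht'
      _ = _ := by ring
  have hmvt := norm_image_sub_le_of_norm_deriv_le_segment_01' hderiv hbound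
  simpa only [one_smul, zero_smul, add_zero, add_sub_cancel] using hmvt

/-! ## §3  Injectivity of `K(W) = eml(F_W) · W` on the window -/

/-- ★★★ **THE EXP-MEAN-LOG GAUGE-FIBRE MAP IS INJECTIVE ON THE SMALL WINDOW.**  For `‖h_i‖ ≤ 1` (off-central `i`), `0 ≤ α ≤ 1/24` and
`m/|I| + 150·α < 1` (`m` = number of off-central indices), the map `W ↦ eml(F_W) · W` is injective on
`{W : ‖W‖ ≤ 1, ‖h_i W* − 1‖ ≤ α for all off-central i}`. [cite: Balaban1987RG1, (0.4) p.253 and p.267] -/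
theorem eml_fibreMap_injOn (hh : ∀ i, ¬ cen i → ‖h i‖ ≤ 1) {α : ℝ} (hα0 : 0 ≤ α) (hα : α ≤ 1 / 24)
    (hgap : ((Finset.univ.filter fun i => ¬ cen i).card : ℝ) / (Fintype.card ι : ℝ) + 150 * α < 1) :
    InjOn (fun W : 𝔸 => eml (fun i => if cen i then (1 : 𝔸) else h i * star W) * W)
      {W : 𝔸 | ‖W‖ ≤ 1 ∧ ∀ i, ¬ cen i → ‖h i * star W - 1‖ ≤ α} := by
  intro W₁ hW₁ W₂ hW₂ heq
  set E₁ := eml (fun i => if cen i then (1 : 𝔸) else h i * star W₁) with hE₁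
  set E₂ := eml (fun i => if cen i then (1 : 𝔸) else h i * star W₂) with hE₂
  have hs0 : 0 ≤ ((Finset.univ.filter fun i => ¬ cen i).card : ℝ) / (Fintype.card ι : ℝ) := by positivity
  -- `‖E₁ − 1‖ ≤ 6α` (for an empty index type `E₁ = eml 1 = 1`)
  have hE₁1 : ‖E₁ - 1‖ ≤ 6 * α := by
    rcases isEmpty_or_nonempty ι with hι | hι
    · have hF : (fun i => if cen i then (1 : 𝔸) else h i * star W₁) = (1 : ι → 𝔸) := funext fun i => isEmptyElim i
      rw [hE₁, hF, BlockAveragingEMLAnalyticMean.eml_one, sub_self, norm_zero]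
      positivity
    · refine norm_eml_sub_one_le_six_mul (fun i => ?_) (by linarith)
      by_cases hc : cen i
      · simp only [hc, if_true, sub_self, norm_zero]; exact hα0
      · simp only [hc, if_false]; exact hW₁.2 i hc
  -- Lipschitz: `‖E₂ − E₁‖ ≤ (s + 144α)‖W₁ − W₂‖`
  have hlip : ‖E₁ - E₂‖ ≤ (((Finset.univ.filter fun i => ¬ cen i).card : ℝ) / (Fintype.card ι : ℝ) + 144 * α) * ‖W₁ - W₂‖ :=
    norm_eml_fibreFamily_sub_le cen h hh hα0 hα hW₁.2 hW₂.2
  -- the identity `E₁ (W₁ − W₂) = (E₂ − E₁) W₂`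
  have hid : E₁ * (W₁ - W₂) = (E₂ - E₁) * W₂ := by
    have : E₁ * W₁ = E₂ * W₂ := heq
    rw [mul_sub, sub_mul, this]
  -- lower bound `(1 − 6α)‖W₁ − W₂‖ ≤ ‖E₁ (W₁ − W₂)‖`
  have hlow : (1 - 6 * α) * ‖W₁ - W₂‖ ≤ ‖E₁ * (W₁ - W₂)‖ := by
    have hX : E₁ * (W₁ - W₂) - (E₁ - 1) * (W₁ - W₂) = W₁ - W₂ := by rw [sub_mul, one_mul]; abel
    have h1 : ‖W₁ - W₂‖ ≤ ‖E₁ * (W₁ - W₂)‖ + ‖(E₁ - 1) * (W₁ - W₂)‖ := by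
      have h := norm_sub_le (E₁ * (W₁ - W₂)) ((E₁ - 1) * (W₁ - W₂))
      rwa [hX] at h
    have h2 : ‖(E₁ - 1) * (W₁ - W₂)‖ ≤ 6 * α * ‖W₁ - W₂‖ :=
      (norm_mul_le _ _).trans (mul_le_mul_of_nonneg_right hE₁1 (norm_nonneg _))
    linarith
  -- upper bound `‖(E₂ − E₁) W₂‖ ≤ (s + 144α)‖W₁ − W₂‖`
  have hup : ‖(E₂ - E₁) * W₂‖ ≤ (((Finset.univ.filter fun i => ¬ cen i).card : ℝ) / (Fintype.card ι : ℝ) + 144 * α) * ‖W₁ - W₂‖ := by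
    calc ‖(E₂ - E₁) * W₂‖ ≤ ‖E₂ - E₁‖ * ‖W₂‖ := norm_mul_le _ _
      _ ≤ ‖E₂ - E₁‖ * 1 := mul_le_mul_of_nonneg_left hW₂.1 (norm_nonneg _)
      _ = ‖E₁ - E₂‖ := by rw [mul_one, norm_sub_rev]
      _ ≤ _ := hlip
  -- conclude
  have hfin : (1 - 6 * α) * ‖W₁ - W₂‖ ≤ (((Finset.univ.filter fun i => ¬ cen i).card : ℝ) / (Fintype.card ι : ℝ) + 144 * α) * ‖W₁ - W₂‖ := by
    rw [hid] at hlow; exact hlow.trans hup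
  have hnorm : ‖W₁ - W₂‖ = 0 := by
    by_contra hne
    have hpos : 0 < ‖W₁ - W₂‖ := lt_of_le_of_ne (norm_nonneg _) (Ne.symm hne)
    have := (mul_le_mul_iff_of_pos_right hpos).1 hfin
    linarith
  exact sub_eq_zero.1 (norm_eq_zero.1 hnorm)

/-- The same, in implication form at two points of the window. [cite: Balaban1987RG1, (0.4) p.253 and p.267] -/
theorem eml_fibreMap_eq_imp_eq (hh : ∀ i, ¬ cen i → ‖h i‖ ≤ 1) {α : ℝ} (hα0 : 0 ≤ α) (hα : α ≤ 1 / 24)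
    (hgap : ((Finset.univ.filter fun i => ¬ cen i).card : ℝ) / (Fintype.card ι : ℝ) + 150 * α < 1) {W₁ W₂ : 𝔸}
    (hW₁ : ‖W₁‖ ≤ 1) (hW₁' : ∀ i, ¬ cen i → ‖h i * star W₁ - 1‖ ≤ α) (hW₂ : ‖W₂‖ ≤ 1) (hW₂' : ∀ i, ¬ cen i → ‖h i * star W₂ - 1‖ ≤ α)
    (heq : eml (fun i => if cen i then (1 : 𝔸) else h i * star W₁) * W₁ = eml (fun i => if cen i then (1 : 𝔸) else h i * star W₂) * W₂) :
    W₁ = W₂ :=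
  eml_fibreMap_injOn cen h hh hα0 hα hgap ⟨hW₁, hW₁'⟩ ⟨hW₂, hW₂'⟩ heq

end Literature.MathematicalPhysics.QuantumFieldTheory.Balaban1983to89.EMLFibreMapInjective

end
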